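import Summits.AtomisticToContinuum.HydrodynamicLimit.Theorems.ImplosionDichotomyPolynomialCompressionLevel1GroupUPrelim
import Literature.Analysis.FluidPDE.MVRelativeEnergyPointwiseBounds

/-!
# Level-1 pointwise bound, group U (velocity pairing with the expanded `∂ₗ f_u`)

Helper file for the line `log-lipschitz-budget` of the crux
`ImplosionDichotomy.PolynomialCompression` (stub `stub_logBudgetShadowing`, blueprint §4, level 1).
At one space-time point, the pairing of the level-1 velocity field `ρ w'ₗⱼ = ρ ∂ₗδuⱼ` with the
`l`-derivative of the velocity forcing of the difference system is bounded by
`(Λ/λ) e₁ + Γ (1 + λ⁻¹)² (1 + Rv) (1 + c₁ + c₁⁻¹)¹² (1 + K + K⁻¹)¹² (m₀ + σ³) √e₁`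
(`level1_groupU_pointwise_bound`, with `Λ = 513 (1 + K) C`, `Γ = 18 (C² + 1)(342 c_Z + 44)`).
The key point is the linearisation of the pressure coefficients: `dA l − dQ l` and
`Δ = θ(ζ0+ζ1)/ρ − K/c₁` vanish at the reference state; with `a = ρ − c₁³`, `b = θ − K c₁²`,
`g = ζ0 + ζ1 − 1` one has `c₁ ρ Δ = K c₁³ g + b (ζ0+ζ1) c₁ − K a`, and every term of the group is
either top × top with a Type-I coefficient (the `c₁`-powers cancel against the weights) or
top × (level 0 / EOS defect) × envelope (`decomp`).  The absorption toolkit (`Level1U.*`), the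
weight domination `level1_groupU_weights_dominate` and the envelope bookkeeping live in the
preliminary file `…Level1GroupUPrelim`; the product bound `amul` is the literature lemma
`CompressibleEuler.abs_mul_le_of_le`.  Pure real-number inequalities.
-/

namespace Summit.AtomisticToContinuum.HydrodynamicLimit.Theorems

open Level1U
-- the product bound `|p q| ≤ P Q` from `|p| ≤ P`, `|q| ≤ Q`, under the short name `amul`
open Literature.Analysis.FluidPDE.CompressibleEuler renaming abs_mul_le_of_le → amul

/-! ### The four groups of terms -/

/-- Algebraic decomposition of one `(l, j)` entry of group U into the convective term, the
transport of second reference derivatives, three top × top cross terms, and a forcing `F₀ x`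
whose coefficient is linear in the level-0 quantities `a, b` and the EOS defects (this is where
`dA l − dQ l` and `Δ` are linearised about the reference state). [folklore] -/
private theorem decomp {K c₁ ρ θ ζ0 ζ1 ζ2 a b x al bl dl dj r2 t2 S1 S2 : ℝ} (hρ : ρ ≠ 0)
    (hc₁ : c₁ ≠ 0) (ha : a = ρ - c₁ ^ 3) (hb : b = θ - K * c₁ ^ 2) :
    ρ * (x * (-S1 - S2 -
      (((2 * K * c₁ * dl + bl) * (ζ0 + ζ1) + θ * (2 * ζ1 + ζ2) / ρ * (3 * c₁ ^ 2 * dl + al)) / ρ -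
          θ * (ζ0 + ζ1) * (3 * c₁ ^ 2 * dl + al) / ρ ^ 2 -
          (2 * K * c₁ * dl / c₁ ^ 3 - K * c₁ ^ 2 * (3 * c₁ ^ 2 * dl) / (c₁ ^ 3) ^ 2)) *
        (3 * c₁ ^ 2 * dj) -
      (θ * (ζ0 + ζ1) / ρ - K * c₁ ^ 2 / c₁ ^ 3) * r2 -
      ζ1 / ρ * (3 * c₁ ^ 2 * dl + al) * (2 * K * c₁ * dj) - (ζ0 - 1) * t2)) =
    ρ * (x * -S1) + -(x * (ρ * S2)) +
      ((-(3 * c₁ ^ 2 * (ζ0 + ζ1) * dj) * x * bl +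
          -(3 * c₁ * (c₁ * θ / ρ) * ((2 * ζ1 + ζ2) - (ζ0 + ζ1)) * dj) * x * al +
          -(2 * K * c₁ * ζ1 * dj) * x * al) +
        (dj * dl * (-(6 * K * c₁ ^ 3 * (ζ0 + ζ1 - 1)) + -(3 * K * a) +
            9 * (c₁ ^ 3 / ρ) * (K * c₁ ^ 3 * (ζ0 + ζ1 - 1) + b * (ζ0 + ζ1) * c₁ + -(K * a)) +
            -(9 * c₁ ^ 3 * (c₁ * θ / ρ) * (2 * ζ1 + ζ2)) + -(6 * K * c₁ ^ 3 * ζ1)) -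
          r2 * c₁⁻¹ * (K * c₁ ^ 3 * (ζ0 + ζ1 - 1) + b * (ζ0 + ζ1) * c₁ + -(K * a)) -
          ρ * (ζ0 - 1) * t2) * x) := by
  subst ha hb
  field_simp
  ring

/-- The three top × top cross terms have Type-I coefficients: `≤ (153/4)(1 + K) ε e₁`.
[folklore] -/
private theorem topS_le {K ε c₁ ρ θ γ μ ζ1 E x al bl dj : ℝ} (hK : 0 < K) (hc₁ : 0 < c₁)
    (hγ1 : γ ≤ 5 / 4) (hγ0 : 0 ≤ γ) (hμ : |μ| ≤ 3 / 8)
    (hζ1 : |ζ1| ≤ 3 / 8) (hτ : |c₁ * θ / ρ| ≤ 3 * K) (hdj : |dj| ≤ ε)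
    (hxa : |x| * |al| ≤ 2 * ((1 + K⁻¹) / c₁) * E)
    (hxb : |x| * |bl| ≤ 2 * ((1 + K) / c₁ ^ 2) * E) :
    -(3 * c₁ ^ 2 * γ * dj) * x * bl + -(3 * c₁ * (c₁ * θ / ρ) * (μ - γ) * dj) * x * al +
        -(2 * K * c₁ * ζ1 * dj) * x * al ≤ 153 / 4 * (1 + K) * ε * E := by
  have h1 : |-(3 * c₁ ^ 2 * γ * dj)| ≤ 3 * c₁ ^ 2 * (5 / 4) * ε := by
    rw [abs_neg]; exact amul (amul (an (by positivity)) (abs_le.2 ⟨by linarith, hγ1⟩)) hdj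
  have h2 : |-(3 * c₁ * (c₁ * θ / ρ) * (μ - γ) * dj)| ≤ 3 * c₁ * (3 * K) * (13 / 8) * ε := by
    rw [abs_neg]
    refine amul (amul (amul (an (by positivity)) hτ) ?_) hdj
    rw [abs_le] at hμ ⊢; constructor <;> linarith [hμ.1, hμ.2]
  have h3 : |-(2 * K * c₁ * ζ1 * dj)| ≤ 2 * K * c₁ * (3 / 8) * ε := by
    rw [abs_neg]; exact amul (amul (an (by positivity)) hζ1) hdj
  have e1 := top_le h1 hxb
  have e2 := top_le h2 hxa
  have e3 := top_le h3 hxa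
  have e : 3 * c₁ ^ 2 * (5 / 4) * ε * (2 * ((1 + K) / c₁ ^ 2) * E) +
      3 * c₁ * (3 * K) * (13 / 8) * ε * (2 * ((1 + K⁻¹) / c₁) * E) +
      2 * K * c₁ * (3 / 8) * ε * (2 * ((1 + K⁻¹) / c₁) * E) = 153 / 4 * (1 + K) * ε * E := by
    field_simp; ring
  linarith

/-- The convective term `−ρ w'ₗⱼ Σᵢ w'ₗᵢ ∂ᵢu₁ⱼ` is Type I: `≤ 18 ε e₁`. [folklore] -/
private theorem conv_le {ρ ε c₁ E x : ℝ} {f g : Fin 3 → ℝ} (hρ : 0 ≤ ρ) (hε : 0 ≤ ε)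
    (hE : 0 ≤ E) (hρc : ρ * (2 / c₁ ^ 3) ≤ 3) (hg : ∀ i, |g i| ≤ ε)
    (hxf : ∀ i, |x| * |f i| ≤ 2 * (2 / c₁ ^ 3) * E) :
    ρ * (x * -∑ i, f i * g i) ≤ 18 * ε * E := by
  have h : ∀ i, -(ρ * g i) * x * f i ≤ ρ * ε * (2 * (2 / c₁ ^ 3) * E) := fun i =>
    top_le (by rw [abs_neg]; exact amul (an hρ) (hg i)) (hxf i)
  have h4 : ρ * (2 / c₁ ^ 3) * (ε * E) ≤ 3 * (ε * E) :=
    mul_le_mul_of_nonneg_right hρc (by positivity)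
  have h0 := h 0; have h1 := h 1; have h2 := h 2
  simp only [Fin.sum_univ_three]
  linarith

/-- Transport of the second reference derivatives by the level-0 velocity:
`−ρ w'ₗⱼ Σᵢ wᵢ ∂ₗ∂ᵢu₁ⱼ ≤ 18 Rv m₀ √e₁`. [folklore] -/
private theorem transport_le {ρ c₁ Rv m₀ E x : ℝ} {w u : Fin 3 → ℝ} (hρ : 0 ≤ ρ) (hRv : 0 ≤ Rv)
    (hm₀ : 0 ≤ m₀) (hρc : ρ * (2 / c₁ ^ 3) ≤ 3) (hu : ∀ i, |u i| ≤ Rv)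
    (hw : ∀ i, |w i| ≤ 2 / c₁ ^ 3 * m₀ * Real.sqrt ρ) (hx : ρ * x ^ 2 ≤ 2 * E) :
    -(x * (ρ * ∑ i, w i * u i)) ≤ 18 * Rv * m₀ * Real.sqrt E := by
  have h : ∀ i, |w i * u i| ≤ 2 / c₁ ^ 3 * m₀ * Real.sqrt ρ * Rv := fun i => amul (hw i) (hu i)
  have hF : |-(ρ * ∑ i, w i * u i)| ≤ 9 * Rv * m₀ * Real.sqrt ρ := by
    rw [abs_neg, abs_mul, abs_of_nonneg hρ, Fin.sum_univ_three]
    have h3 := abs_add_three (w 0 * u 0) (w 1 * u 1) (w 2 * u 2)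
    calc ρ * |w 0 * u 0 + w 1 * u 1 + w 2 * u 2|
        ≤ ρ * (3 * (2 / c₁ ^ 3 * m₀ * Real.sqrt ρ * Rv)) := by
          apply mul_le_mul_of_nonneg_left _ hρ; linarith [h 0, h 1, h 2]
      _ = ρ * (2 / c₁ ^ 3) * (3 * (m₀ * Real.sqrt ρ * Rv)) := by ring
      _ ≤ 3 * (3 * (m₀ * Real.sqrt ρ * Rv)) := mul_le_mul_of_nonneg_right hρc (by positivity)
      _ = 9 * Rv * m₀ * Real.sqrt ρ := by ring
  have := forcing_le hρ (by positivity : (0 : ℝ) ≤ 9 * Rv * m₀) hx hF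
  linarith

/-- The forcing `F₀ x`: level 1 × (level 0 or EOS defect) × Type-I/`Rv` coefficients, in units of
the envelope scale `V`: `≤ 2 N₀ V⁴ √e₁`. [folklore] -/
private theorem F0_le {K cZ s3 ε Rv V c₁ ρ θ γ g μ ζ1 z a b m₀ E x dj dl r2 t2 : ℝ}
    (hcZ : 0 ≤ cZ) (hs3 : 0 ≤ s3) (hRv : 0 ≤ Rv) (hρ : 0 ≤ ρ) (hm₀ : 0 ≤ m₀) (hKV : |K| ≤ V)
    (hc1V : |c₁| ≤ V) (hc3V : |c₁ ^ 3| ≤ V) (hciV : |c₁⁻¹| ≤ V) (hq : |c₁ ^ 3 / ρ| ≤ 2)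
    (hτV : |c₁ * θ / ρ| ≤ 3 * V) (hρV : |ρ| ≤ 2 * V ^ 3)
    (hγ : |γ| ≤ 5 / 4) (haV : |a| ≤ V ^ 2 * m₀ * Real.sqrt ρ)
    (hbV : |b| ≤ V ^ 2 * m₀ * Real.sqrt ρ) (hgV : |g| ≤ 6 * cZ * s3 * V * Real.sqrt ρ)
    (hμV : |μ| ≤ 6 * cZ * s3 * V * Real.sqrt ρ) (hζ1V : |ζ1| ≤ 6 * cZ * s3 * V * Real.sqrt ρ)
    (hzV : |z| ≤ 6 * cZ * s3 * V * Real.sqrt ρ) (hdjV : |dj| ≤ ε * V) (hdl : |dl| ≤ ε)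
    (hr2 : |r2| ≤ Rv) (ht2 : |t2| ≤ Rv) (hx : ρ * x ^ 2 ≤ 2 * E) :
    (dj * dl * (-(6 * K * c₁ ^ 3 * g) + -(3 * K * a) +
        9 * (c₁ ^ 3 / ρ) * (K * c₁ ^ 3 * g + b * γ * c₁ + -(K * a)) +
        -(9 * c₁ ^ 3 * (c₁ * θ / ρ) * μ) + -(6 * K * c₁ ^ 3 * ζ1)) -
      r2 * c₁⁻¹ * (K * c₁ ^ 3 * g + b * γ * c₁ + -(K * a)) - ρ * z * t2) * x ≤
    2 * ((ε ^ 2 * (342 * cZ * s3 + 87 / 2 * m₀) + Rv * (18 * cZ * s3 + 9 / 4 * m₀)) * V ^ 4) *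
      Real.sqrt E := by
  set Y := Real.sqrt ρ with hY
  set D := K * c₁ ^ 3 * g + b * γ * c₁ + -(K * a) with hD
  have hD3 : |D| ≤ (6 * cZ * s3 + 9 / 4 * m₀) * V ^ 3 * Y := by
    refine (abs_add_three _ _ _).trans ?_
    have h1 := amul (amul hKV hc3V) hgV
    have h2 := amul (amul hbV hγ) hc1V
    have h3 := (abs_neg _).trans_le (amul hKV haV)
    exact (add_le_add (add_le_add h1 h2) h3).trans_eq (by ring)
  set Φ := -(6 * K * c₁ ^ 3 * g) + -(3 * K * a) + 9 * (c₁ ^ 3 / ρ) * D +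
    -(9 * c₁ ^ 3 * (c₁ * θ / ρ) * μ) + -(6 * K * c₁ ^ 3 * ζ1) with hΦ
  have hΦb : |Φ| ≤ (342 * cZ * s3 + 87 / 2 * m₀) * V ^ 3 * Y := by
    refine (abs_add_five _ _ _ _ _).trans ?_
    have h1 := (abs_neg _).trans_le
      (amul (amul (amul (an (by norm_num : (0 : ℝ) ≤ 6)) hKV) hc3V) hgV)
    have h2 := (abs_neg _).trans_le (amul (amul (an (by norm_num : (0 : ℝ) ≤ 3)) hKV) haV)
    have h3 := amul (amul (an (by norm_num : (0 : ℝ) ≤ 9)) hq) hD3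
    have h4 := (abs_neg _).trans_le
      (amul (amul (amul (an (by norm_num : (0 : ℝ) ≤ 9)) hc3V) hτV) hμV)
    have h5 := (abs_neg _).trans_le
      (amul (amul (amul (an (by norm_num : (0 : ℝ) ≤ 6)) hKV) hc3V) hζ1V)
    exact (add_le_add (add_le_add (add_le_add (add_le_add h1 h2) h3) h4) h5).trans_eq (by ring)
  have hF : |dj * dl * Φ - r2 * c₁⁻¹ * D - ρ * z * t2| ≤
      ((ε ^ 2 * (342 * cZ * s3 + 87 / 2 * m₀) + Rv * (18 * cZ * s3 + 9 / 4 * m₀)) * V ^ 4)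
        * Y := by
    refine ((abs_sub (dj * dl * Φ - r2 * c₁⁻¹ * D) (ρ * z * t2)).trans
      (add_le_add (abs_sub (dj * dl * Φ) (r2 * c₁⁻¹ * D)) le_rfl)).trans ?_
    have h1 := amul (amul hdjV hdl) hΦb
    have h2 := amul (amul hr2 hciV) hD3
    have h3 := amul (amul hρV hzV) ht2
    exact (add_le_add (add_le_add h1 h2) h3).trans_eq (by ring)
  exact forcing_le hρ (by positivity) hx hF

/-! ### The pointwise bound -/

/-- One `(l, j)` entry of group U, with the weights `A`, `B`, the energy `e₁ = E` and the level-0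
size `m₀` abstracted into their defining relations. [folklore] -/
private theorem main (K C cZ lam c₁ ρ θ ζ0 ζ1 ζ2 s3 Rv a b A B E m₀ : ℝ)
    (du₁ : Fin 3 → Fin 3 → ℝ) (dc₁ : Fin 3 → ℝ) (d2ρ₁ d2θ₁ : Fin 3 → Fin 3 → ℝ)
    (d2u₁ : Fin 3 → Fin 3 → Fin 3 → ℝ) (w a' b' : Fin 3 → ℝ) (w' : Fin 3 → Fin 3 → ℝ)
    (l j : Fin 3) (hK : 0 < K) (hC : 0 ≤ C) (hcZ : 0 ≤ cZ) (hlam : 0 < lam) (hc₁ : 0 < c₁)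
    (hs3 : 0 ≤ s3) (hRv : 0 ≤ Rv) (hpack : ρ * s3 * (cZ + 1) ≤ 1 / 8)
    (hζ0 : |ζ0 - 1| ≤ cZ * (ρ * s3)) (hζ1 : |ζ1| ≤ cZ * (ρ * s3)) (hζ2 : |ζ2| ≤ cZ * (ρ * s3))
    (ha : a = ρ - c₁ ^ 3) (hb : b = θ - K * c₁ ^ 2) (haabs : |a| ≤ c₁ ^ 3 / 2)
    (hbabs : |b| ≤ K * c₁ ^ 2 / 2) (hdu₁ : ∀ i j, |du₁ i j| ≤ C / lam)
    (hdc₁ : ∀ i, |dc₁ i| ≤ C / lam) (hd2ρ : ∀ i j, |d2ρ₁ i j| ≤ Rv)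
    (hd2θ : ∀ i j, |d2θ₁ i j| ≤ Rv) (hd2u : ∀ i j k, |d2u₁ i j k| ≤ Rv)
    (hA : A = θ * (ζ0 + ζ1) / ρ) (hB : B = 3 / 2 * ρ / θ) (hm₀ : 0 ≤ m₀)
    (hEw : ∀ l j, ρ * w' l j ^ 2 ≤ 2 * E) (hEa : ∀ l, A * a' l ^ 2 ≤ 2 * E)
    (hEb : ∀ l, B * b' l ^ 2 ≤ 2 * E) (hma : Real.sqrt A * |a| ≤ m₀)
    (hmw : ∀ i, Real.sqrt ρ * |w i| ≤ m₀) (hmb : Real.sqrt B * |b| ≤ m₀) :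
    ρ * (w' l j * (-(∑ i, w' l i * du₁ i j) - ∑ i, w i * d2u₁ l i j -
      (((2 * K * c₁ * dc₁ l + b' l) * (ζ0 + ζ1) +
              θ * (2 * ζ1 + ζ2) / ρ * (3 * c₁ ^ 2 * dc₁ l + a' l)) / ρ -
          θ * (ζ0 + ζ1) * (3 * c₁ ^ 2 * dc₁ l + a' l) / ρ ^ 2 -
          (2 * K * c₁ * dc₁ l / c₁ ^ 3 - K * c₁ ^ 2 * (3 * c₁ ^ 2 * dc₁ l) / (c₁ ^ 3) ^ 2)) *
        (3 * c₁ ^ 2 * dc₁ j) -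
      (θ * (ζ0 + ζ1) / ρ - K * c₁ ^ 2 / c₁ ^ 3) * d2ρ₁ l j -
      ζ1 / ρ * (3 * c₁ ^ 2 * dc₁ l + a' l) * (2 * K * c₁ * dc₁ j) - (ζ0 - 1) * d2θ₁ l j)) ≤
    57 * (1 + K) * (C * lam⁻¹) * E + 2 * (C ^ 2 + 1) * (342 * cZ + 44) * (1 + lam⁻¹) ^ 2 *
      (1 + Rv) * ((1 + c₁ + c₁⁻¹) ^ 12 * (1 + K + K⁻¹) ^ 12) * (m₀ + s3) * Real.sqrt E := by
  obtain ⟨ha1, ha2⟩ := abs_le.1 haabs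
  obtain ⟨hb1, hb2⟩ := abs_le.1 hbabs
  have hc3 : 0 < c₁ ^ 3 := by positivity
  have hKc : 0 < K * c₁ ^ 2 := by positivity
  have hρlo : c₁ ^ 3 / 2 ≤ ρ := by linarith
  have hρhi : ρ ≤ 3 / 2 * c₁ ^ 3 := by linarith
  have hθlo : K * c₁ ^ 2 / 2 ≤ θ := by linarith
  have hθhi : θ ≤ 3 / 2 * (K * c₁ ^ 2) := by linarith
  have hρ : 0 < ρ := by linarith
  have hθ : 0 < θ := by linarith
  have hη0 : 0 ≤ cZ * (ρ * s3) := by positivity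
  have hη : cZ * (ρ * s3) ≤ 1 / 8 := by
    have e : ρ * s3 * (cZ + 1) = cZ * (ρ * s3) + ρ * s3 := by ring
    linarith [mul_nonneg hρ.le hs3]
  obtain ⟨hz1, hz2⟩ := abs_le.1 hζ0
  obtain ⟨hy1, hy2⟩ := abs_le.1 hζ1
  obtain ⟨hx1, hx2⟩ := abs_le.1 hζ2
  have hγ0 : 3 / 4 ≤ ζ0 + ζ1 := by linarith
  have hγ1 : ζ0 + ζ1 ≤ 5 / 4 := by linarith
  have hγ0' : 0 ≤ ζ0 + ζ1 := by linarith
  have hγabs : |ζ0 + ζ1| ≤ 5 / 4 := abs_le.2 ⟨by linarith, hγ1⟩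
  have hμ38 : |2 * ζ1 + ζ2| ≤ 3 / 8 := abs_le.2 ⟨by linarith, by linarith⟩
  have hζ138 : |ζ1| ≤ 3 / 8 := abs_le.2 ⟨by linarith, by linarith⟩
  have hE : 0 ≤ E := by linarith [hEw l j, mul_nonneg hρ.le (sq_nonneg (w' l j))]
  -- the derivative scale `C / lam = C * lam⁻¹`
  have hL0 : 0 ≤ lam⁻¹ := (inv_pos.2 hlam).le
  have hCL : C / lam = C * lam⁻¹ := div_eq_mul_inv C lam
  simp only [hCL] at hdu₁ hdc₁
  -- the envelope scale `V`
  obtain ⟨hV1, hKV, hc1V, hc3V, hciV, hκaV, hκbV, hVW⟩ := env_facts hK hc₁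
  set W := (1 + c₁ + c₁⁻¹) ^ 12 * (1 + K + K⁻¹) ^ 12
  set V := (1 + c₁ + c₁⁻¹) ^ 3 * (1 + K + K⁻¹)
  clear_value V W
  have hV0 : 0 ≤ V := zero_le_one.trans hV1
  have hVV : V ≤ V ^ 2 := le_self_pow₀ hV1 two_ne_zero
  have hV3 : V ≤ V ^ 3 := le_self_pow₀ hV1 three_ne_zero
  have hW1 : 1 ≤ W := (one_le_pow₀ hV1).trans hVW
  -- weights versus reference sizes
  have hA0 : 0 ≤ A := by rw [hA]; exact div_nonneg (mul_nonneg hθ.le hγ0') hρ.le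
  have hB0 : 0 ≤ B := by rw [hB]; positivity
  have hAρ : ρ * A = θ * (ζ0 + ζ1) := by rw [hA]; field_simp
  obtain ⟨hκa, hκb, hκw⟩ :=
    level1_groupU_weights_dominate K c₁ ρ θ (ζ0 + ζ1) hK hc₁ hρlo hθlo hθhi hγ0
  have hκa' : 1 ≤ ((1 + K⁻¹) / c₁) ^ 2 * (ρ * A) := by rwa [hAρ]
  have hκb' : 1 ≤ ((1 + K) / c₁ ^ 2) ^ 2 * (ρ * B) := by rwa [hB]
  have hxa : |w' l j| * |a' l| ≤ 2 * ((1 + K⁻¹) / c₁) * E :=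
    prod_le hA0 (by positivity) hE (hEw l j) (hEa l) hκa'
  have hxb : |w' l j| * |b' l| ≤ 2 * ((1 + K) / c₁ ^ 2) * E :=
    prod_le hB0 (by positivity) hE (hEw l j) (hEb l) hκb'
  have hxw : ∀ i, |w' l j| * |w' l i| ≤ 2 * (2 / c₁ ^ 3) * E := fun i =>
    prod_le hρ.le (by positivity) hE (hEw l j) (hEw l i) hκw
  -- level-0 amplitudes in units of `m₀ √ρ`
  have hsρ := Real.sqrt_nonneg ρ
  have haV : |a| ≤ V ^ 2 * m₀ * Real.sqrt ρ :=
    (amp_le hma hκa' (by positivity) hρ.le).trans (by gcongr; exact hκaV.trans hVV)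
  have hbV : |b| ≤ V ^ 2 * m₀ * Real.sqrt ρ :=
    (amp_le hmb hκb' (by positivity) hρ.le).trans (by gcongr; exact hκbV.trans hVV)
  have hwV : ∀ i, |w i| ≤ 2 / c₁ ^ 3 * m₀ * Real.sqrt ρ := fun i =>
    amp_le (hmw i) hκw (by positivity) hρ.le
  -- reference sizes
  have hρc : ρ * (2 / c₁ ^ 3) ≤ 3 := by
    rw [← mul_div_assoc, div_le_iff₀ hc3]; linarith
  have hτ : c₁ * θ / ρ ≤ 3 * K := by
    rw [div_le_iff₀ hρ]
    calc c₁ * θ ≤ c₁ * (3 / 2 * (K * c₁ ^ 2)) := mul_le_mul_of_nonneg_left hθhi hc₁.le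
      _ = 3 * K * (c₁ ^ 3 / 2) := by ring
      _ ≤ 3 * K * ρ := mul_le_mul_of_nonneg_left hρlo (by positivity)
  have hτabs : |c₁ * θ / ρ| ≤ 3 * K := (an (by positivity)).trans hτ
  have hτV : |c₁ * θ / ρ| ≤ 3 * V := hτabs.trans (by linarith)
  have hq : |c₁ ^ 3 / ρ| ≤ 2 := (an (by positivity)).trans (by rw [div_le_iff₀ hρ]; linarith)
  have hρV : |ρ| ≤ 2 * V ^ 3 := (an hρ.le).trans (by linarith)
  -- EOS defects in units of `s3 √ρ`
  have hsq : Real.sqrt ρ ≤ 2 * V := by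
    rw [Real.sqrt_le_left (by positivity)]; linarith
  have hρs : ρ ≤ 2 * V * Real.sqrt ρ :=
    calc ρ = Real.sqrt ρ * Real.sqrt ρ := (Real.mul_self_sqrt hρ.le).symm
      _ ≤ 2 * V * Real.sqrt ρ := mul_le_mul_of_nonneg_right hsq hsρ
  have hdef : 3 * (cZ * (ρ * s3)) ≤ 6 * cZ * s3 * V * Real.sqrt ρ := by
    have := mul_le_mul_of_nonneg_left hρs (by positivity : (0 : ℝ) ≤ 3 * cZ * s3); linarith
  have hgV : |ζ0 + ζ1 - 1| ≤ 6 * cZ * s3 * V * Real.sqrt ρ :=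
    (abs_le.2 ⟨by linarith, by linarith⟩ : |ζ0 + ζ1 - 1| ≤ 3 * (cZ * (ρ * s3))).trans hdef
  have hμV : |2 * ζ1 + ζ2| ≤ 6 * cZ * s3 * V * Real.sqrt ρ :=
    (abs_le.2 ⟨by linarith, by linarith⟩ : |2 * ζ1 + ζ2| ≤ 3 * (cZ * (ρ * s3))).trans hdef
  have hζ1V : |ζ1| ≤ 6 * cZ * s3 * V * Real.sqrt ρ := (hζ1.trans (by linarith)).trans hdef
  have hzV : |ζ0 - 1| ≤ 6 * cZ * s3 * V * Real.sqrt ρ := (hζ0.trans (by linarith)).trans hdef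
  -- Type-I sizes
  have hdjV : |dc₁ j| ≤ C * lam⁻¹ * V :=
    (hdc₁ j).trans (le_mul_of_one_le_right (by positivity) hV1)
  -- the four groups
  rw [decomp hρ.ne' hc₁.ne' ha hb]
  have h1 := conv_le hρ.le (by positivity : 0 ≤ C * lam⁻¹) hE hρc (fun i => hdu₁ i j) hxw
  have h2 := transport_le hρ.le hRv hm₀ hρc (fun i => hd2u l i j) hwV (hEw l j)
  have h3 := topS_le hK hc₁ hγ1 hγ0' hμ38 hζ138 hτabs (hdc₁ j) hxa hxb
  have h4 := F0_le hcZ hs3 hRv hρ.le hm₀ ((an hK.le).trans hKV) ((an hc₁.le).trans hc1V)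
    ((an hc3.le).trans hc3V) ((an (inv_pos.2 hc₁).le).trans hciV) hq hτV hρV hγabs haV hbV
    hgV hμV hζ1V hzV hdjV (hdc₁ l) (hd2ρ l j) (hd2θ l j) (hEw l j)
  have h5 := mul_le_mul_of_nonneg_right
    (env_final (ε := C * lam⁻¹) hL0 hRv hcZ hs3 hm₀ rfl hVW hW1) (Real.sqrt_nonneg E)
  have hKCE : 0 ≤ K * (C * lam⁻¹) * E := by positivity
  have hCE : 0 ≤ C * lam⁻¹ * E := by positivity
  linarith

/-- **Level-1 pointwise bound, group U** (helper toward `stub_logBudgetShadowing`, line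
`log-lipschitz-budget`, blueprint §4 level 1).  Given `K > 0`, `C, Cb, c_Z ≥ 0` there are
`Λ, Γ ≥ 0` (here `Λ = 513 (1 + K) C`, `Γ = 18 (C² + 1)(342 c_Z + 44)`) such that at every point of
the bootstrap regime the pairing of the level-1 velocity field `ρ w'ₗⱼ` with the expanded
`∂ₗ f_u` — convective term, transport of second reference derivatives (`≤ Rv`), the linearised
pressure coefficient `(dA l − dQ l) ∂ⱼρ₁`, `Δ ∂ₗ∂ⱼρ₁`, `(ζ1/ρ) ∂ₗρ ∂ⱼθ₁` and `(ζ0 − 1) ∂ₗ∂ⱼθ₁` — is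
at most `(Λ/λ) e₁ + Γ (1 + λ⁻¹)² (1 + Rv) (1 + c₁ + c₁⁻¹)¹² (1 + K + K⁻¹)¹² (m₀ + σ³) √e₁`.
[folklore] -/
theorem level1_groupU_pointwise_bound :
    ∀ (K C Cb cZ : ℝ), 0 < K → 0 ≤ C → 0 ≤ Cb → 0 ≤ cZ →
      ∃ Λ Γ : ℝ, 0 ≤ Λ ∧ 0 ≤ Γ ∧
        ∀ (lam c₁ ρ θ ζ0 ζ1 ζ2 s3 Rv : ℝ) (du₁ : Fin 3 → Fin 3 → ℝ) (dc₁ : Fin 3 → ℝ)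
          (d2ρ₁ d2θ₁ : Fin 3 → Fin 3 → ℝ) (d2u₁ : Fin 3 → Fin 3 → Fin 3 → ℝ)
          (a b : ℝ) (w : Fin 3 → ℝ) (a' b' : Fin 3 → ℝ) (w' : Fin 3 → Fin 3 → ℝ),
          0 < lam → 0 < c₁ → 0 ≤ s3 → 0 ≤ Rv → ρ * s3 * (cZ + 1) ≤ 1 / 8 →
          |ζ0 - 1| ≤ cZ * (ρ * s3) → |ζ1| ≤ cZ * (ρ * s3) → |ζ2| ≤ cZ * (ρ * s3) →
          a = ρ - c₁ ^ 3 → b = θ - K * c₁ ^ 2 → |a| ≤ c₁ ^ 3 / 2 → |b| ≤ K * c₁ ^ 2 / 2 →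
          (∀ i j, |du₁ i j| ≤ C / lam) → (∀ i, |dc₁ i| ≤ C / lam) →
          (∀ i j, |d2ρ₁ i j| ≤ Rv) → (∀ i j, |d2θ₁ i j| ≤ Rv) → (∀ i j k, |d2u₁ i j k| ≤ Rv) →
          (∀ l j, |w' l j| ≤ Cb / lam) → (∀ l, Real.sqrt K * c₁ * |a' l| / c₁ ^ 3 ≤ Cb / lam) →
          (∀ l, |b' l| / (Real.sqrt K * c₁) ≤ Cb / lam) →
          let A := θ * (ζ0 + ζ1) / ρ
          let B := 3 / 2 * ρ / θ
          let dρ : Fin 3 → ℝ := fun l => 3 * c₁ ^ 2 * dc₁ l + a' l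
          let dθ : Fin 3 → ℝ := fun l => 2 * K * c₁ * dc₁ l + b' l
          let dA : Fin 3 → ℝ := fun l =>
            (dθ l * (ζ0 + ζ1) + θ * (2 * ζ1 + ζ2) / ρ * dρ l) / ρ - θ * (ζ0 + ζ1) * dρ l / ρ ^ 2
          let dQ : Fin 3 → ℝ := fun l => 2 * K * c₁ * dc₁ l / c₁ ^ 3 - K * c₁ ^ 2 * (3 * c₁ ^ 2 * dc₁ l) / (c₁ ^ 3) ^ 2
          let Δ := θ * (ζ0 + ζ1) / ρ - K * c₁ ^ 2 / c₁ ^ 3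
          let e₁ := ∑ l, 1 / 2 * (A * (a' l) ^ 2 + ρ * ∑ j, (w' l j) ^ 2 + B * (b' l) ^ 2)
          let m₀ := Real.sqrt A * |a| + Real.sqrt ρ * Real.sqrt (∑ j, (w j) ^ 2) + Real.sqrt B * |b|
          ∑ l, ρ * ∑ j, w' l j *
              (-(∑ i, w' l i * du₁ i j) - ∑ i, w i * d2u₁ l i j - (dA l - dQ l) * (3 * c₁ ^ 2 * dc₁ j) -
                Δ * d2ρ₁ l j - ζ1 / ρ * dρ l * (2 * K * c₁ * dc₁ j) - (ζ0 - 1) * d2θ₁ l j)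
            ≤ Λ / lam * e₁ +
              Γ * (1 + lam⁻¹) ^ 2 * (1 + Rv) * (1 + c₁ + c₁⁻¹) ^ 12 * (1 + K + K⁻¹) ^ 12 * (m₀ + s3) *
                Real.sqrt e₁ := by
  intro K C Cb cZ hK hC hCb hcZ
  refine ⟨513 * (1 + K) * C, 18 * (C ^ 2 + 1) * (342 * cZ + 44), by positivity, by positivity, ?_⟩
  intro lam c₁ ρ θ ζ0 ζ1 ζ2 s3 Rv du₁ dc₁ d2ρ₁ d2θ₁ d2u₁ a b w a' b' w' hlam hc₁ hs3 hRv hpack hζ0 hζ1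
    hζ2 ha hb haabs hbabs hdu₁ hdc₁ hd2ρ hd2θ hd2u _ _ _ A B dρ dθ dA dQ Δ e₁ m₀
  obtain ⟨ha1, ha2⟩ := abs_le.1 haabs
  obtain ⟨hb1, hb2⟩ := abs_le.1 hbabs
  have hc3 : 0 < c₁ ^ 3 := by positivity
  have hKc : 0 < K * c₁ ^ 2 := by positivity
  have hρ : 0 < ρ := by linarith
  have hθ : 0 < θ := by linarith
  have hγ : 0 < ζ0 + ζ1 := by
    have e : ρ * s3 * (cZ + 1) = cZ * (ρ * s3) + ρ * s3 := by ring
    have hη : cZ * (ρ * s3) ≤ 1 / 8 := by linarith [mul_nonneg hρ.le hs3]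
    linarith [(abs_le.1 hζ0).1, (abs_le.1 hζ1).1]
  have hA : 0 < A := div_pos (mul_pos hθ hγ) hρ
  have hB : 0 < B := show 0 < 3 / 2 * ρ / θ by positivity
  -- the energy controls each level-1 entry
  have hsum : ∀ l, 1 / 2 * (A * a' l ^ 2 + ρ * ∑ j, w' l j ^ 2 + B * b' l ^ 2) ≤ e₁ := fun l =>
    Finset.single_le_sum (f := fun l => 1 / 2 * (A * a' l ^ 2 + ρ * ∑ j, w' l j ^ 2 + B * b' l ^ 2))
      (fun i _ => by positivity) (Finset.mem_univ l)
  have hS : ∀ l, 0 ≤ ρ * ∑ j, w' l j ^ 2 := fun l => by positivity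
  have hEw : ∀ l j, ρ * w' l j ^ 2 ≤ 2 * e₁ := fun l j => by
    have h1 : w' l j ^ 2 ≤ ∑ j, w' l j ^ 2 :=
      Finset.single_le_sum (f := fun j => w' l j ^ 2) (fun i _ => sq_nonneg _) (Finset.mem_univ j)
    have h2 := mul_le_mul_of_nonneg_left h1 hρ.le
    linarith [hsum l, mul_nonneg hA.le (sq_nonneg (a' l)), mul_nonneg hB.le (sq_nonneg (b' l))]
  have hEa : ∀ l, A * a' l ^ 2 ≤ 2 * e₁ := fun l => by
    linarith [hsum l, hS l, mul_nonneg hB.le (sq_nonneg (b' l))]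
  have hEb : ∀ l, B * b' l ^ 2 ≤ 2 * e₁ := fun l => by
    linarith [hsum l, hS l, mul_nonneg hA.le (sq_nonneg (a' l))]
  -- the level-0 size controls each level-0 entry
  have h0a : 0 ≤ Real.sqrt A * |a| := by positivity
  have h0b : 0 ≤ Real.sqrt B * |b| := by positivity
  have h0w : 0 ≤ Real.sqrt ρ * Real.sqrt (∑ j, w j ^ 2) := by positivity
  have hma : Real.sqrt A * |a| ≤ m₀ := by
    show _ ≤ Real.sqrt A * |a| + Real.sqrt ρ * Real.sqrt (∑ j, w j ^ 2) + Real.sqrt B * |b|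
    linarith
  have hmb : Real.sqrt B * |b| ≤ m₀ := by
    show _ ≤ Real.sqrt A * |a| + Real.sqrt ρ * Real.sqrt (∑ j, w j ^ 2) + Real.sqrt B * |b|
    linarith
  have hmw : ∀ i, Real.sqrt ρ * |w i| ≤ m₀ := fun i => by
    have h1 : |w i| ≤ Real.sqrt (∑ j, w j ^ 2) := by
      rw [← Real.sqrt_sq_eq_abs]
      exact Real.sqrt_le_sqrt
        (Finset.single_le_sum (f := fun j => w j ^ 2) (fun k _ => sq_nonneg _) (Finset.mem_univ i))
    have h2 := mul_le_mul_of_nonneg_left h1 (Real.sqrt_nonneg ρ)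
    show _ ≤ Real.sqrt A * |a| + Real.sqrt ρ * Real.sqrt (∑ j, w j ^ 2) + Real.sqrt B * |b|
    linarith
  have hm₀ : 0 ≤ m₀ := h0a.trans hma
  have key := fun l j => main K C cZ lam c₁ ρ θ ζ0 ζ1 ζ2 s3 Rv a b A B e₁ m₀ du₁ dc₁ d2ρ₁ d2θ₁
    d2u₁ w a' b' w' l j hK hC hcZ hlam hc₁ hs3 hRv hpack hζ0 hζ1 hζ2 ha hb haabs hbabs hdu₁ hdc₁
    hd2ρ hd2θ hd2u rfl rfl hm₀ hEw hEa hEb hma hmw hmb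
  refine (sum9 key).trans (le_of_eq ?_)
  generalize (1 + c₁ + c₁⁻¹) ^ 12 = X
  generalize (1 + K + K⁻¹) ^ 12 = Y
  ring

end Summit.AtomisticToContinuum.HydrodynamicLimit.Theorems
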